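import Summits.CriticalPhenomena.PercolationContinuityZ3.Theorems.PercNearOneGluingNoHeavyLowerTailSahiHittingMeetFourBoxData
import HarnessLib

/-!
# `NoHeavyLowerTail` (stmt-CriticalPhenomena-4575) — kernel certificates `A` for the meet-row polynomial `E_4(1_{H_0∩H_1},1_{H_2},1_{H_3},1_{H_4})` on `[0,1]³¹`

Support file, seat `prim-l12-p5` (gen 16), `--supports stmt-CriticalPhenomena-4575`.  COMPUTATIONAL: `native_decide` runs of `SahiHitting.boxcheckK`
(pruned recursive Bernstein slicing with the monomial-domination leaf test, `…SahiHittingBoxRecursive`) on the vertex pre-slices `m4SliceS s` of `m4K`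
(`…SahiHittingMeetFourBoxData`), for the vertices `s` listed below (node counts from the seat engine `code/slicecount.py`; this file ≈ 3,345,251 nodes);
assembled in `…SahiHittingMeetFour`.  No sorries. [this work]
-/

namespace Summit.CriticalPhenomena.PercolationContinuityZ3.Theorems

namespace SahiHitting

/-- Certificate for the vertex `s = (1, 1, 1, 1, 1, 1)` (3,345,251 recursion nodes). [this work] -/
theorem m4_cert_111111 : boxcheckK m4VarsRest (m4SliceS 1 1 1 1 1 1) = true := by
  native_decide

end SahiHitting

end Summit.CriticalPhenomena.PercolationContinuityZ3.Theorems
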